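import Summits.ValiantsHypothesis.ValiantsHypothesis.Theorems.BarrierLeverPartitionMinorsHitByVPCorankRepair

/-!
# Route BarrierLever — Chow witnesses for partition minors (items 20195 / 20172): appending
# `y`-only factors is a containment-triangular column operation

Helper file (`--supports stmt-ValiantsHypothesis-20195`; cell valiant-natproofs, rung V4, 𝒟-side of
door (c); seat val-np-p4 gen 10; planner valiant-natproofs-p1 g14's MEMO-thinrows-proofplan §2).
Closes NO item; imports only the Mathlib/Literature-level `…PartitionMinorsHitByVPCorankRepair`
(for the exponent bookkeeping `partitionExpo_apply_castAdd/natAdd`, `partitionExpo_eq_iff`).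

Conventions of items 19717 / 20172 / 20195: in `MvPolynomial (Fin (h+h)) R`, `x_a = X (castAdd h a)`,
`y_c = X (natAdd h c)`, and the partition-matrix entry of `f` at `(u, w)` is the coefficient of the
exponent `E u w = Σ_{a ∈ u} single (castAdd h a) 1 + Σ_{c ∈ w} single (natAdd h c) 1` (verbatim the
items' `Finsupp`).  A polynomial `g` is `y`-ONLY when no monomial of its support involves an `x_a`.

* `coeff_partitionExpo_mul_yOnly` — **for `y`-only `g` and any `f`:
  `coeff (E u w) (f * g) = Σ_{d ⊆ w} coeff (E u (w \ d)) f * coeff (E ∅ d) g`.**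
  In matrix words (planner's §2): `M_{f·g} = M_f · R_g` with `R_g[z, w] = [z ⊆ w] · coeff_{y^{w∖z}} g`,
  unit upper-triangular in the containment order when `g` has constant term `1` — so appending
  `y`-only affine factors to a Chow witness acts on the partition matrix by an INVERTIBLE column
  operator, the algebraic core of the induction «on the number of appended generic `y`-only forms».
* `coeff_partitionExpo_mul_affineY` — the one-form case `g = 1 + Σ_c b_c y_c`:
  `coeff (E u w) (f * g) = coeff (E u w) f + Σ_{c ∈ w} b_c · coeff (E u (w.erase c)) f`
  (the planner's «`R = I + Σ_c g_c S_c`» with the up-operators `S_c`), proved directly;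
* `coeff_partitionExpo_mul_affine` — a GENERAL affine factor `ℓ = C c₀ + Σ_a α_a x_a + Σ_c b_c y_c`:
  `coeff (E u w) (f·ℓ) = c₀·coeff (E u w) f + Σ_{a∈u} α_a·coeff (E (u.erase a) w) f + Σ_{c∈w} b_c·coeff (E u (w.erase c)) f`,
  and `coeff_partitionExpo_affine` — the partition coefficients of `ℓ` itself (`c₀` at `(∅,∅)`, `α_a` at
  `({a},∅)`, `b_c` at `(∅,{c})`, zero elsewhere);
* the exponent lemmas they rest on: `yOnly_le_partitionExpo` (a `y`-only exponent below `E u w` is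
  `E ∅ d` for the set `d ⊆ w` of its `y`-variables), `partitionExpo_tsub` (`E u w - E ∅ d = E u (w \ d)`),
  `partitionExpo_tsub_single`, `natAdd_mem_support_partitionExpo`.

WHAT THIS IS NOT: bookkeeping for the thin-row line; nothing on items 20195 / 20172 / 19717 themselves,
on crux stmt-ValiantsHypothesis-14610, or on `VP` versus `VNP`.
-/

set_option linter.dupNamespace false

namespace Summit.ValiantsHypothesis.ValiantsHypothesis.Theorems.BarrierLever.ChowFactor

open Finset MvPolynomial
open Summit.ValiantsHypothesis.ValiantsHypothesis.Theorems.BarrierLever.ProductStateSums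
  (castAdd_ne_natAdd partitionExpo_apply_castAdd partitionExpo_apply_natAdd)
open Summit.ValiantsHypothesis.ValiantsHypothesis.Theorems.BarrierLever.CorankRepair (partitionExpo_eq_iff)

variable {h : ℕ}

/-! ## 1. Exponent bookkeeping -/

/-- **A `y`-only exponent below `E u w` is `E ∅ d` for the set `d ⊆ w` of its `y`-variables.** -/
theorem yOnly_le_partitionExpo (u w : Finset (Fin h)) (s : Fin (h + h) →₀ ℕ)
    (hs : ∀ a : Fin h, s (Fin.castAdd h a) = 0)
    (hle : s ≤ ∑ a ∈ u, Finsupp.single (Fin.castAdd h a) 1 + ∑ c ∈ w, Finsupp.single (Fin.natAdd h c) 1) :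
    s = ∑ a ∈ (∅ : Finset (Fin h)), Finsupp.single (Fin.castAdd h a) 1 +
      ∑ c ∈ w.filter (fun c => s (Fin.natAdd h c) ≠ 0), Finsupp.single (Fin.natAdd h c) 1 := by
  ext i
  induction i using Fin.addCases with
  | left a =>
    rw [hs a]
    have e := partitionExpo_apply_castAdd (h := h) ∅ (w.filter fun c => s (Fin.natAdd h c) ≠ 0) a
    simp only [Finset.notMem_empty, if_false] at e
    exact e.symm
  | right c =>
    have e := partitionExpo_apply_natAdd (h := h) ∅ (w.filter fun c => s (Fin.natAdd h c) ≠ 0) c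
    rw [e]
    have hc := hle (Fin.natAdd h c)
    rw [partitionExpo_apply_natAdd] at hc
    by_cases hcw : c ∈ w
    · rw [if_pos hcw] at hc
      by_cases h0 : s (Fin.natAdd h c) = 0
      · rw [h0, if_neg (fun hm : c ∈ w.filter (fun c => s (Fin.natAdd h c) ≠ 0) =>
          (Finset.mem_filter.mp hm).2 h0)]
      · rw [if_pos (Finset.mem_filter.mpr ⟨hcw, h0⟩)]
        omega
    · rw [if_neg hcw] at hc
      have h0 : s (Fin.natAdd h c) = 0 := by omega
      rw [h0, if_neg (fun hm : c ∈ w.filter (fun c => s (Fin.natAdd h c) ≠ 0) =>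
        (Finset.mem_filter.mp hm).2 h0)]

/-- **Subtracting a `y`-part**: `E u w - E ∅ d = E u (w \ d)` (truncated subtraction; no
hypothesis `d ⊆ w` is needed). -/
theorem partitionExpo_tsub (u w d : Finset (Fin h)) :
    ((∑ a ∈ u, Finsupp.single (Fin.castAdd h a) 1 + ∑ c ∈ w, Finsupp.single (Fin.natAdd h c) 1 :
        Fin (h + h) →₀ ℕ) -
      (∑ a ∈ (∅ : Finset (Fin h)), Finsupp.single (Fin.castAdd h a) 1 +
        ∑ c ∈ d, Finsupp.single (Fin.natAdd h c) 1)) =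
      ∑ a ∈ u, Finsupp.single (Fin.castAdd h a) 1 + ∑ c ∈ w \ d, Finsupp.single (Fin.natAdd h c) 1 := by
  ext i
  rw [Finsupp.tsub_apply]
  induction i using Fin.addCases with
  | left a =>
    rw [partitionExpo_apply_castAdd, partitionExpo_apply_castAdd, partitionExpo_apply_castAdd]
    simp
  | right c =>
    rw [partitionExpo_apply_natAdd, partitionExpo_apply_natAdd, partitionExpo_apply_natAdd]
    by_cases hcw : c ∈ w <;> by_cases hcd : c ∈ d <;> simp [hcw, hcd, Finset.mem_sdiff]

/-- The `y`-part `E ∅ d` lies below `E u w` when `d ⊆ w`. -/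
theorem partitionExpo_empty_le (u w d : Finset (Fin h)) (hd : d ⊆ w) :
    ((∑ a ∈ (∅ : Finset (Fin h)), Finsupp.single (Fin.castAdd h a) 1 +
        ∑ c ∈ d, Finsupp.single (Fin.natAdd h c) 1 : Fin (h + h) →₀ ℕ)) ≤
      ∑ a ∈ u, Finsupp.single (Fin.castAdd h a) 1 + ∑ c ∈ w, Finsupp.single (Fin.natAdd h c) 1 := by
  intro i
  induction i using Fin.addCases with
  | left a =>
    rw [partitionExpo_apply_castAdd, partitionExpo_apply_castAdd]
    simp
  | right c =>
    rw [partitionExpo_apply_natAdd, partitionExpo_apply_natAdd]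
    by_cases hcd : c ∈ d
    · rw [if_pos hcd, if_pos (hd hcd)]
    · rw [if_neg hcd]
      exact Nat.zero_le _

/-! ## 2. Appending a `y`-only factor -/

/-- **Appending a `y`-only factor is a containment-triangular column operation** (planner g14's
MEMO-thinrows §2): for `y`-only `g` (no monomial of `g` involves an `x`-variable) and any `f`,
`coeff (E u w) (f * g) = Σ_{d ⊆ w} coeff (E u (w \ d)) f * coeff (E ∅ d) g`. -/
theorem coeff_partitionExpo_mul_yOnly {R : Type*} [CommSemiring R] (f g : MvPolynomial (Fin (h + h)) R)
    (hg : ∀ s ∈ g.support, ∀ a : Fin h, s (Fin.castAdd h a) = 0) (u w : Finset (Fin h)) :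
    coeff (∑ a ∈ u, Finsupp.single (Fin.castAdd h a) 1 + ∑ c ∈ w, Finsupp.single (Fin.natAdd h c) 1)
        (f * g) =
      ∑ d ∈ w.powerset,
        coeff (∑ a ∈ u, Finsupp.single (Fin.castAdd h a) 1 +
            ∑ c ∈ w \ d, Finsupp.single (Fin.natAdd h c) 1) f *
          coeff (∑ a ∈ (∅ : Finset (Fin h)), Finsupp.single (Fin.castAdd h a) 1 +
            ∑ c ∈ d, Finsupp.single (Fin.natAdd h c) 1) g := by
  classical
  set n : Fin (h + h) →₀ ℕ :=
    ∑ a ∈ u, Finsupp.single (Fin.castAdd h a) 1 + ∑ c ∈ w, Finsupp.single (Fin.natAdd h c) 1 with hn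
  -- the `y`-part map `d ↦ E ∅ d`
  set ψ : Finset (Fin h) → (Fin (h + h) →₀ ℕ) := fun d =>
    ∑ a ∈ (∅ : Finset (Fin h)), Finsupp.single (Fin.castAdd h a) 1 +
      ∑ c ∈ d, Finsupp.single (Fin.natAdd h c) 1 with hψ
  have hψinj : Function.Injective ψ := by
    intro d d' hdd
    exact ((partitionExpo_eq_iff ∅ d ∅ d').mp hdd).2
  -- the summand as a function of the `y`-part `s`
  set F : (Fin (h + h) →₀ ℕ) → R := fun s => if s ≤ n then coeff (n - s) f * coeff s g else 0 with hF
  -- (1) expand `g` over its support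
  have hL : coeff n (f * g) = ∑ s ∈ g.support, F s := by
    conv_lhs => rw [g.as_sum, Finset.mul_sum]
    rw [coeff_sum]
    refine Finset.sum_congr rfl fun s _ => ?_
    rw [coeff_mul_monomial']
  -- (2) the right-hand side is the sum of `F` over the image of `ψ`
  have hR : ∑ d ∈ w.powerset,
      coeff (∑ a ∈ u, Finsupp.single (Fin.castAdd h a) 1 +
          ∑ c ∈ w \ d, Finsupp.single (Fin.natAdd h c) 1) f * coeff (ψ d) g =
      ∑ s ∈ w.powerset.image ψ, F s := by
    rw [Finset.sum_image fun d _ d' _ hdd => hψinj hdd]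
    refine Finset.sum_congr rfl fun d hd => ?_
    have hdw : d ⊆ w := Finset.mem_powerset.mp hd
    have hle : ψ d ≤ n := partitionExpo_empty_le u w d hdw
    rw [hF]
    dsimp only
    rw [if_pos hle, hn, hψ, partitionExpo_tsub u w d]
  rw [hL, hR]
  -- (3) both are the sum of `F` over the union: `F` vanishes off the support and off the image
  have hzero_supp : ∀ s, s ∉ g.support → F s = 0 := by
    intro s hs
    rw [hF]
    dsimp only
    rw [MvPolynomial.notMem_support_iff.mp hs, mul_zero, ite_self]
  have hzero_img : ∀ s, s ∉ w.powerset.image ψ → F s = 0 := by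
    intro s hs
    rw [hF]
    dsimp only
    by_cases hle : s ≤ n
    · rw [if_pos hle]
      by_cases hsg : s ∈ g.support
      · exfalso
        apply hs
        rw [Finset.mem_image]
        refine ⟨w.filter (fun c => s (Fin.natAdd h c) ≠ 0), Finset.mem_powerset.mpr
          (Finset.filter_subset _ _), ?_⟩
        rw [hψ]
        exact (yOnly_le_partitionExpo u w s (hg s hsg) hle).symm
      · rw [MvPolynomial.notMem_support_iff.mp hsg, mul_zero]
    · rw [if_neg hle]
  rw [Finset.sum_subset (Finset.subset_union_left (s₂ := w.powerset.image ψ))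
      (fun s _ hs => hzero_supp s hs),
    Finset.sum_subset (Finset.subset_union_right (s₁ := g.support))
      (fun s _ hs => hzero_img s hs)]

/-! ## 3. One affine `y`-only factor: `R = 1 + Σ_c b_c S_c` -/

/-- The `y`-support of the partition exponent: `natAdd c ∈ supp (E u w) ↔ c ∈ w`. -/
theorem natAdd_mem_support_partitionExpo (u w : Finset (Fin h)) (c : Fin h) :
    Fin.natAdd h c ∈ (∑ a ∈ u, Finsupp.single (Fin.castAdd h a) 1 +
        ∑ c ∈ w, Finsupp.single (Fin.natAdd h c) 1 : Fin (h + h) →₀ ℕ).support ↔ c ∈ w := by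
  rw [Finsupp.mem_support_iff, partitionExpo_apply_natAdd]
  by_cases hc : c ∈ w <;> simp [hc]

/-- Removing one `y`-variable: `E u w - single (natAdd c) 1 = E u (w.erase c)`. -/
theorem partitionExpo_tsub_single (u w : Finset (Fin h)) (c : Fin h) :
    ((∑ a ∈ u, Finsupp.single (Fin.castAdd h a) 1 + ∑ c ∈ w, Finsupp.single (Fin.natAdd h c) 1 :
        Fin (h + h) →₀ ℕ) - Finsupp.single (Fin.natAdd h c) 1) =
      ∑ a ∈ u, Finsupp.single (Fin.castAdd h a) 1 +
        ∑ c' ∈ w.erase c, Finsupp.single (Fin.natAdd h c') 1 := by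
  have e := partitionExpo_tsub u w {c}
  rw [Finset.sum_empty, zero_add, Finset.sum_singleton, Finset.sdiff_singleton_eq_erase] at e
  exact e

/-- **One affine `y`-only factor** (planner g14's MEMO-thinrows §2, «`R = I + Σ_c g_c S_c` with the
up-operators `S_c`»): for any `f` and coefficients `b`,
`coeff (E u w) (f * (1 + Σ_c b_c y_c)) = coeff (E u w) f + Σ_{c ∈ w} b_c * coeff (E u (w.erase c)) f`. -/
theorem coeff_partitionExpo_mul_affineY {R : Type*} [CommSemiring R]
    (f : MvPolynomial (Fin (h + h)) R) (b : Fin h → R) (u w : Finset (Fin h)) :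
    coeff (∑ a ∈ u, Finsupp.single (Fin.castAdd h a) 1 + ∑ c ∈ w, Finsupp.single (Fin.natAdd h c) 1)
        (f * (1 + ∑ c, C (b c) * X (Fin.natAdd h c))) =
      coeff (∑ a ∈ u, Finsupp.single (Fin.castAdd h a) 1 +
          ∑ c ∈ w, Finsupp.single (Fin.natAdd h c) 1) f +
        ∑ c ∈ w, b c * coeff (∑ a ∈ u, Finsupp.single (Fin.castAdd h a) 1 +
          ∑ c' ∈ w.erase c, Finsupp.single (Fin.natAdd h c') 1) f := by
  classical
  rw [mul_add, mul_one, coeff_add, Finset.mul_sum, coeff_sum]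
  congr 1
  have hterm : ∀ c : Fin h,
      coeff (∑ a ∈ u, Finsupp.single (Fin.castAdd h a) 1 + ∑ c ∈ w, Finsupp.single (Fin.natAdd h c) 1)
          (f * (C (b c) * X (Fin.natAdd h c))) =
        if c ∈ w then b c * coeff (∑ a ∈ u, Finsupp.single (Fin.castAdd h a) 1 +
          ∑ c' ∈ w.erase c, Finsupp.single (Fin.natAdd h c') 1) f else 0 := by
    intro c
    rw [mul_left_comm, coeff_C_mul, coeff_mul_X']
    by_cases hc : c ∈ w
    · rw [if_pos ((natAdd_mem_support_partitionExpo u w c).mpr hc), partitionExpo_tsub_single,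
        if_pos hc]
    · rw [if_neg (fun hm => hc ((natAdd_mem_support_partitionExpo u w c).mp hm)), if_neg hc,
        mul_zero]
  simp_rw [hterm]
  rw [← Finset.sum_filter, Finset.filter_univ_mem]

/-! ## 4. The `x`-side twin and a general affine factor -/

/-- The `x`-support of the partition exponent: `castAdd a ∈ supp (E u w) ↔ a ∈ u`. -/
theorem castAdd_mem_support_partitionExpo (u w : Finset (Fin h)) (a : Fin h) :
    Fin.castAdd h a ∈ (∑ a' ∈ u, Finsupp.single (Fin.castAdd h a') 1 +
        ∑ c ∈ w, Finsupp.single (Fin.natAdd h c) 1 : Fin (h + h) →₀ ℕ).support ↔ a ∈ u := by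
  rw [Finsupp.mem_support_iff, partitionExpo_apply_castAdd]
  by_cases ha : a ∈ u <;> simp [ha]

/-- Removing one `x`-variable: `E u w - single (castAdd a) 1 = E (u.erase a) w`. -/
theorem partitionExpo_tsub_single_castAdd (u w : Finset (Fin h)) (a : Fin h) :
    ((∑ a' ∈ u, Finsupp.single (Fin.castAdd h a') 1 + ∑ c ∈ w, Finsupp.single (Fin.natAdd h c) 1 :
        Fin (h + h) →₀ ℕ) - Finsupp.single (Fin.castAdd h a) 1) =
      ∑ a' ∈ u.erase a, Finsupp.single (Fin.castAdd h a') 1 +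
        ∑ c ∈ w, Finsupp.single (Fin.natAdd h c) 1 := by
  ext i
  rw [Finsupp.tsub_apply]
  induction i using Fin.addCases with
  | left b =>
    rw [partitionExpo_apply_castAdd, partitionExpo_apply_castAdd, Finsupp.single_apply]
    by_cases hb : b = a
    · subst hb
      by_cases hbu : b ∈ u <;> simp [hbu]
    · have hne : Fin.castAdd h a ≠ Fin.castAdd h b := fun e => hb (Fin.castAdd_injective _ _ e).symm
      rw [if_neg hne]
      simp [hb, Finset.mem_erase]
  | right d =>
    rw [partitionExpo_apply_natAdd, partitionExpo_apply_natAdd, Finsupp.single_apply,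
      if_neg (castAdd_ne_natAdd a d)]
    simp

/-- **One general affine factor**: for any `f`, constants `c₀`, `x`-coefficients `α` and
`y`-coefficients `b`,
`coeff (E u w) (f * (C c₀ + Σ_a α_a x_a + Σ_c b_c y_c)) = c₀ · coeff (E u w) f
  + Σ_{a ∈ u} α_a · coeff (E (u.erase a) w) f + Σ_{c ∈ w} b_c · coeff (E u (w.erase c)) f`
(the partition matrix of `f · ℓ` for an affine form `ℓ`: diagonal, `x`-up and `y`-up operators). -/
theorem coeff_partitionExpo_mul_affine {R : Type*} [CommSemiring R]
    (f : MvPolynomial (Fin (h + h)) R) (c₀ : R) (α b : Fin h → R) (u w : Finset (Fin h)) :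
    coeff (∑ a ∈ u, Finsupp.single (Fin.castAdd h a) 1 + ∑ c ∈ w, Finsupp.single (Fin.natAdd h c) 1)
        (f * (C c₀ + ∑ a, C (α a) * X (Fin.castAdd h a) + ∑ c, C (b c) * X (Fin.natAdd h c))) =
      c₀ * coeff (∑ a ∈ u, Finsupp.single (Fin.castAdd h a) 1 +
          ∑ c ∈ w, Finsupp.single (Fin.natAdd h c) 1) f +
        ∑ a ∈ u, α a * coeff (∑ a' ∈ u.erase a, Finsupp.single (Fin.castAdd h a') 1 +
          ∑ c ∈ w, Finsupp.single (Fin.natAdd h c) 1) f +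
        ∑ c ∈ w, b c * coeff (∑ a ∈ u, Finsupp.single (Fin.castAdd h a) 1 +
          ∑ c' ∈ w.erase c, Finsupp.single (Fin.natAdd h c') 1) f := by
  classical
  rw [mul_add, mul_add, coeff_add, coeff_add, Finset.mul_sum, Finset.mul_sum, coeff_sum, coeff_sum]
  congr 1
  congr 1
  · rw [mul_comm, coeff_C_mul]
  · have hterm : ∀ a : Fin h,
        coeff (∑ a ∈ u, Finsupp.single (Fin.castAdd h a) 1 + ∑ c ∈ w, Finsupp.single (Fin.natAdd h c) 1)
            (f * (C (α a) * X (Fin.castAdd h a))) =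
          if a ∈ u then α a * coeff (∑ a' ∈ u.erase a, Finsupp.single (Fin.castAdd h a') 1 +
            ∑ c ∈ w, Finsupp.single (Fin.natAdd h c) 1) f else 0 := by
      intro a
      rw [mul_left_comm, coeff_C_mul, coeff_mul_X']
      by_cases ha : a ∈ u
      · rw [if_pos ((castAdd_mem_support_partitionExpo u w a).mpr ha),
          partitionExpo_tsub_single_castAdd, if_pos ha]
      · rw [if_neg (fun hm => ha ((castAdd_mem_support_partitionExpo u w a).mp hm)), if_neg ha,
          mul_zero]
    simp_rw [hterm]
    rw [← Finset.sum_filter, Finset.filter_univ_mem]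
  · have hterm : ∀ c : Fin h,
        coeff (∑ a ∈ u, Finsupp.single (Fin.castAdd h a) 1 + ∑ c ∈ w, Finsupp.single (Fin.natAdd h c) 1)
            (f * (C (b c) * X (Fin.natAdd h c))) =
          if c ∈ w then b c * coeff (∑ a ∈ u, Finsupp.single (Fin.castAdd h a) 1 +
            ∑ c' ∈ w.erase c, Finsupp.single (Fin.natAdd h c') 1) f else 0 := by
      intro c
      rw [mul_left_comm, coeff_C_mul, coeff_mul_X']
      by_cases hc : c ∈ w
      · rw [if_pos ((natAdd_mem_support_partitionExpo u w c).mpr hc), partitionExpo_tsub_single,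
          if_pos hc]
      · rw [if_neg (fun hm => hc ((natAdd_mem_support_partitionExpo u w c).mp hm)), if_neg hc,
          mul_zero]
    simp_rw [hterm]
    rw [← Finset.sum_filter, Finset.filter_univ_mem]

/-- **The partition coefficients of an affine form**: `coeff (E u w) (C c₀ + Σ_a α_a x_a + Σ_c b_c y_c)`
is `c₀` at `(∅, ∅)`, `α_a` at `({a}, ∅)`, `b_c` at `(∅, {c})`, and `0` at every other layout entry. -/
theorem coeff_partitionExpo_affine {R : Type*} [CommSemiring R] (c₀ : R) (α b : Fin h → R)
    (u w : Finset (Fin h)) :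
    coeff (∑ a ∈ u, Finsupp.single (Fin.castAdd h a) 1 + ∑ c ∈ w, Finsupp.single (Fin.natAdd h c) 1)
        (C c₀ + ∑ a, C (α a) * X (Fin.castAdd h a) + ∑ c, C (b c) * X (Fin.natAdd h c) :
          MvPolynomial (Fin (h + h)) R) =
      (if u = ∅ ∧ w = ∅ then c₀ else 0) + ∑ a ∈ u, (if u = {a} ∧ w = ∅ then α a else 0) +
        ∑ c ∈ w, (if u = ∅ ∧ w = {c} then b c else 0) := by
  classical
  have e := coeff_partitionExpo_mul_affine (1 : MvPolynomial (Fin (h + h)) R) c₀ α b u w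
  rw [one_mul] at e
  rw [e]
  -- `coeff (E u' w') 1 = [u' = ∅ ∧ w' = ∅]`
  have hone : ∀ u' w' : Finset (Fin h),
      coeff (∑ a ∈ u', Finsupp.single (Fin.castAdd h a) 1 + ∑ c ∈ w', Finsupp.single (Fin.natAdd h c) 1)
        (1 : MvPolynomial (Fin (h + h)) R) = if u' = ∅ ∧ w' = ∅ then 1 else 0 := by
    intro u' w'
    rw [coeff_one]
    have key : ((∑ a ∈ u', Finsupp.single (Fin.castAdd h a) 1 +
        ∑ c ∈ w', Finsupp.single (Fin.natAdd h c) 1 : Fin (h + h) →₀ ℕ) = 0) ↔ u' = ∅ ∧ w' = ∅ := by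
      have e0 : (0 : Fin (h + h) →₀ ℕ) = ∑ a ∈ (∅ : Finset (Fin h)), Finsupp.single (Fin.castAdd h a) 1 +
          ∑ c ∈ (∅ : Finset (Fin h)), Finsupp.single (Fin.natAdd h c) 1 := by simp
      rw [e0, partitionExpo_eq_iff]
    by_cases h0 : u' = ∅ ∧ w' = ∅
    · rw [if_pos (key.mpr h0).symm, if_pos h0]
    · rw [if_neg (fun e' => h0 (key.mp e'.symm)), if_neg h0]
  simp_rw [hone]
  congr 1
  congr 1
  · by_cases h0 : u = ∅ ∧ w = ∅ <;> simp [h0]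
  · refine Finset.sum_congr rfl fun a ha => ?_
    have hiff : (u.erase a = ∅ ∧ w = ∅) ↔ (u = {a} ∧ w = ∅) := by
      constructor
      · rintro ⟨hu, hw⟩
        refine ⟨?_, hw⟩
        ext x
        rw [Finset.mem_singleton]
        constructor
        · intro hx
          by_contra hxa
          have : x ∈ u.erase a := Finset.mem_erase.mpr ⟨hxa, hx⟩
          rw [hu] at this
          exact absurd this (Finset.notMem_empty x)
        · rintro rfl
          exact ha
      · rintro ⟨hu, hw⟩
        exact ⟨by rw [hu, Finset.erase_singleton], hw⟩
    by_cases h1 : u.erase a = ∅ ∧ w = ∅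
    · rw [if_pos h1, if_pos (hiff.mp h1), mul_one]
    · rw [if_neg h1, if_neg (fun h2 => h1 (hiff.mpr h2)), mul_zero]
  · refine Finset.sum_congr rfl fun c hc => ?_
    have hiff : (u = ∅ ∧ w.erase c = ∅) ↔ (u = ∅ ∧ w = {c}) := by
      constructor
      · rintro ⟨hu, hw⟩
        refine ⟨hu, ?_⟩
        ext x
        rw [Finset.mem_singleton]
        constructor
        · intro hx
          by_contra hxc
          have : x ∈ w.erase c := Finset.mem_erase.mpr ⟨hxc, hx⟩
          rw [hw] at this
          exact absurd this (Finset.notMem_empty x)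
        · rintro rfl
          exact hc
      · rintro ⟨hu, hw⟩
        exact ⟨hu, by rw [hw, Finset.erase_singleton]⟩
    by_cases h1 : u = ∅ ∧ w.erase c = ∅
    · rw [if_pos h1, if_pos (hiff.mp h1), mul_one]
    · rw [if_neg h1, if_neg (fun h2 => h1 (hiff.mpr h2)), mul_zero]

end Summit.ValiantsHypothesis.ValiantsHypothesis.Theorems.BarrierLever.ChowFactor
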